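/-
Copyright: see repository. [cite: CossartPiltant2008, Section 9, Lemma 9.4 (HAL p. 29 l. 48–59)]
-/
import Literature.AlgebraicGeometry.CossartPiltant200819.MonomialChartCentre2008

/-!
# Cossart–Piltant 2008, Lemma 9.4 — node N2a carved: lifting the corrections `γ₂, γ₃` through
  the residue field is PROVED; the monomial-chart leaf becomes coefficient-free

[CP-I] V. Cossart, O. Piltant, *Resolution of singularities of threefolds in positive
characteristic. I.*, J. Algebra **320** (2008) 1051–1082, HAL hal-00139124 (page/line locators
"HAL p. N l. M" refer to the HAL version, as in the rest of this directory).

`MonomialChartCentre2008` reduced node N2 of the proof of Lemma 9.4 (HAL p. 29 l. 48–59) to the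
`G`-free leaf `MonomialChartCentre`: for ANY set of coefficients `F ⊆ S` mapping onto `κ(S)`,
the centre of `W` on the chart `S₁ := (S[y])_{m_W ∩ S[y]}` is generated by the `y_i` of positive
value and `d - #I₊` polynomial values `P_j(y_{I₀})` with coefficients in `F`.  The quantifier
over `F` is the printed "`κ(R₁) = κ(S₁)`, so that there exist `γ₂, γ₃ ∈ R₁` such that `S₁` has
r.s.p. `(y₁, y₂ − γ₂, y₃ − γ₃)`" (l. 55–56): the corrections `γ` are LIFTS of residues.  This
file PROVES that lifting step and leaves the smaller leaf

* `MonomialChartCentreSelf` (HYPOTHESIS, `F`-free — l. 48–49 "`S₁ := S̄_{m_W ∩ S̄}` is a local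
  model of `W` and `S₁` is regular by (b)" in generator form): the maximal ideal of the pinned
  chart is generated by the `y_i` of positive value and `d - #I₊` values `P_j(y_{I₀})` of
  polynomials `P_j ∈ S[Y_{I₀}]` (coefficients anywhere in `S`);

and PROVES the glue `monomialChartCentre_of_self : MonomialChartCentreSelf → MonomialChartCentre`
(l. 55–56): replace every coefficient `c` of `P_j` by a lift `c' ∈ F` of its residue.  The new
values `P'_j(y_{I₀})` differ from the old ones by `∑ (c' - c)·y^n` with `c' - c ∈ m_S`; since
`m_S = (x)` and, by property (b) of the printed basis (`C = V⁻¹ ≥ 0`, l. 28),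
`x_j = ∏_i y_i^{C_{ji}}` (`eq_prod_zpow_of_mul_eq_one`) with some `C_{ji} ≥ 1`, `W(y_i) > 0`
(as `W(x_j) > 0`), every `x_j` — hence all of `m_S·S₁` — lies in the ideal generated by the
`y_i` of positive value (`l. 48–49`, "by (b)"); so the two generating sets generate the same
ideal.  Ingredients PROVED here: the parameters `x_j` are non-zero (a regular local ring of
dimension `d` is not generated by `d - 1` elements, Krull), the inversion of the unimodular
monomial change of variables (53), and the comparison of the two ideals.

Re-threading (PROVED): `monomialChartRegular_of_self`, `tamePrimeDescentViaStableModelRoots_of_self`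
(the Roots leaf of HAL p. 29 l. 14–65 from the single `F`-free, `G`-free leaf),
`tamePrimeDescent_of_self_of_inertia`, and the directory's dependency statements with
`MonomialChartCentreSelf` in place of `MonomialChartCentre`.

What remains hypothesis-only below the Roots leaf after this file: `MonomialChartCentreSelf` —
on paper: `S₁/(y_{I₊})S₁` is a localisation of a quotient of `κ(S)[Y_{I₀}]` at the centre of
`W`, a maximal ideal since `κ(W)/k` is algebraic (`residueTrdeg = 0`), generated by `#I₀`
elements.
-/

namespace Literature.AlgebraicGeometry.CossartPiltant200819.CP2008

open Literature.AlgebraicGeometry.Resolution IsLocalRing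
open scoped Pointwise

universe u

/-! ## The unimodular monomial change of variables (53) and its inverse (property (b)) -/

section Inversion

variable {L : Type u} [Field L]

/-- `a^(∑ f) = ∏ a^(f i)` for `a ≠ 0` (integer exponents). [folklore] -/
private theorem zpow_finset_sum {a : L} (ha : a ≠ 0) {ι : Type*} (s : Finset ι) (f : ι → ℤ) :
    a ^ (∑ i ∈ s, f i) = ∏ i ∈ s, a ^ f i := by
  classical
  induction s using Finset.induction_on with
  | empty => simp
  | insert i s hi ih => rw [Finset.sum_insert hi, Finset.prod_insert hi, zpow_add₀ ha, ih]

/-- Inversion of the change of variables (53) `y_i := ∏_j x_j^{v_{ij}}` for a unimodular `V`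
with inverse `C`: `x_j = ∏_i y_i^{C_{ji}}` (HAL p. 29 l. 25–28: "(v₁, v₂, v₃) a basis of `ℤ³`
… (b) `ℕ³ ⊆ ℕv₁ + ℕv₂ + ℕv₃`", i.e. `C ≥ 0`).
[cite: CossartPiltant2008, Section 9, Lemma 9.4 (HAL p. 29 l. 25–35)] -/
theorem eq_prod_zpow_of_mul_eq_one {d : ℕ} {x y : Fin d → L} (hx : ∀ j, x j ≠ 0)
    {V C : Matrix (Fin d) (Fin d) ℤ} (hVC : V * C = 1) (hy : ∀ i, y i = ∏ j, x j ^ V i j)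
    (j : Fin d) : x j = ∏ i, y i ^ C j i := by
  have hCV : C * V = 1 := mul_eq_one_comm.mp hVC
  have h1 : ∀ j', (∑ i, C j i * V i j') = if j = j' then 1 else 0 := fun j' => by
    have h := congrFun (congrFun hCV j) j'
    rw [Matrix.mul_apply, Matrix.one_apply] at h
    exact h
  symm
  calc ∏ i, y i ^ C j i = ∏ i, (∏ j', x j' ^ V i j') ^ C j i :=
        Finset.prod_congr rfl fun i _ => by rw [hy i]
    _ = ∏ i, ∏ j', x j' ^ (C j i * V i j') := by
        refine Finset.prod_congr rfl fun i _ => ?_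
        rw [← Finset.prod_zpow]
        exact Finset.prod_congr rfl fun j' _ => by rw [mul_comm, zpow_mul]
    _ = ∏ j', ∏ i, x j' ^ (C j i * V i j') := Finset.prod_comm
    _ = ∏ j', x j' ^ (∑ i, C j i * V i j') :=
        Finset.prod_congr rfl fun j' _ => (zpow_finset_sum (hx j') _ _).symm
    _ = x j := by
        rw [Finset.prod_eq_single j (fun j' _ hj' => by
          rw [h1 j', if_neg (Ne.symm hj'), zpow_zero]) (fun h => absurd (Finset.mem_univ j) h)]
        rw [h1 j, if_pos rfl, zpow_one]

/-- The same inversion with natural exponents when `C ≥ 0` (property (b)).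
[cite: CossartPiltant2008, Section 9, Lemma 9.4 (HAL p. 29 l. 25–35)] -/
theorem eq_prod_pow_toNat_of_mul_eq_one {d : ℕ} {x y : Fin d → L} (hx : ∀ j, x j ≠ 0)
    {V C : Matrix (Fin d) (Fin d) ℤ} (hVC : V * C = 1) (hC : ∀ i j, 0 ≤ C i j)
    (hy : ∀ i, y i = ∏ j, x j ^ V i j) (j : Fin d) : x j = ∏ i, y i ^ (C j i).toNat := by
  rw [eq_prod_zpow_of_mul_eq_one hx hVC hy j]
  exact Finset.prod_congr rfl fun i _ => by rw [← zpow_natCast, Int.toNat_of_nonneg (hC j i)]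

/-- The members of a regular system of parameters are non-zero: a regular local ring of
dimension `d` has no generating set of its maximal ideal with fewer than `d` elements (Krull).
[folklore] -/
private theorem ne_zero_of_span_eq_maximalIdeal {k : Type u} [Field k] [Algebra k L]
    (S : Subalgebra k L) [IsRegularLocalRing S] {d : ℕ} {x : Fin d → L}
    (hspan : Ideal.span {s : S | (s : L) ∈ Set.range x} = maximalIdeal S)
    (hdim : ringKrullDim S = d) (j : Fin d) : x j ≠ 0 := by
  classical
  intro h0
  have hfin : {s : S | (s : L) ∈ Set.range x}.Finite :=
    (Set.finite_range x).preimage Subtype.val_injective.injOn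
  have h0T : (0 : S) ∈ {s : S | (s : L) ∈ Set.range x} := ⟨j, by rw [h0]; rfl⟩
  have hcard : ({s : S | (s : L) ∈ Set.range x} \ {0}).ncard + 1 ≤ d := by
    rw [Set.ncard_sdiff_singleton_add_one h0T hfin,
      ← Set.ncard_image_of_injective _ Subtype.val_injective]
    refine (Set.ncard_le_ncard ?_ (Set.finite_range x)).trans ?_
    · rintro _ ⟨s, hs, rfl⟩
      exact hs
    · calc (Set.range x).ncard ≤ (Set.univ : Set (Fin d)).ncard := by
            rw [← Set.image_univ]; exact Set.ncard_image_le Set.finite_univ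
        _ = d := by rw [Set.ncard_univ, Nat.card_eq_fintype_card, Fintype.card_fin]
  have hspan' : Ideal.span ({s : S | (s : L) ∈ Set.range x} \ {0}) = maximalIdeal S := by
    rw [← hspan, ← Ideal.span_insert_zero, Set.insert_sdiff_singleton, Set.insert_eq_of_mem h0T]
  have hle : ringKrullDim S ≤ (({s : S | (s : L) ∈ Set.range x} \ {0}).ncard : WithBot ℕ∞) := by
    refine (ringKrullDim_le_spanFinrank_maximalIdeal S).trans ?_
    rw [← hspan']
    exact_mod_cast Submodule.spanFinrank_span_le_ncard_of_finite (hfin.subset Set.sdiff_subset)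
  rw [hdim] at hle
  have hle' : d ≤ ({s : S | (s : L) ∈ Set.range x} \ {0}).ncard := by exact_mod_cast hle
  omega

end Inversion

/-! ## The leaf: the centre of `W` on the monomial chart, coefficients anywhere in `S` -/

section

/-- **Node N2a′ (HYPOTHESIS; `G`-free and coefficient-free).** [CP-I] Lemma 9.4, HAL p. 29
l. 48–49: "`S̄ := S[y₁, y₂, y₃]`. By (c), `S₁ := S̄_{m_W ∩ S̄}` is a local model of `W` and `S₁`
is regular by (b)", in generator form.  For a regular local model `S` of `W` (`κ(W)/k`
algebraic) with r.s.p. `x = (x_j)_{j < d}`, a unimodular `V` with inverse `C ≥ 0`, and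
`y := x^V ⊆ W`: the maximal ideal of the pinned chart `S₁ := (S[y])_{m_W ∩ S[y]}` is generated
by the `y_i` with `W(y_i) > 0` together with `m` values `P_j(y_{I₀})`, `I₀ := {i | W(y_i) = 0}`,
of polynomials `P_j ∈ S[Y_{I₀}]`, where `#{i | W(y_i) > 0} + m = d`.  On paper: by (b),
`x = y^C` with `C ≥ 0`, so `m_S ⊆ (y_{I₊})S[y]` and `S₁/(y_{I₊})S₁` is a localisation of a
quotient of `κ(S)[Y_{I₀}]` at the centre `𝔫` of `W`; `𝔫` is a maximal ideal because
`κ(S)[ȳ_{I₀}] ⊆ κ(W)` is algebraic over `k`, hence generated by `#I₀` polynomials, whose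
coefficients lift to `S`.  The lifting of the coefficients into an arbitrary `F ↠ κ(S)`
(l. 55–56, "there exist `γ₂, γ₃ ∈ R₁`") is PROVED below (`monomialChartCentre_of_self`).
[cite: CossartPiltant2008, Section 9, Lemma 9.4 (HAL p. 29 l. 48–49)] -/
def MonomialChartCentreSelf : Prop :=
  ∀ (k L : Type u) [Field k] [Field L] [Algebra k L]
    (W : ValuationSubring L) (hk : ∀ c : k, algebraMap k L c ∈ W), residueTrdeg k W hk = 0 →
    ∀ (S : Subalgebra k L) [IsRegularLocalRing S], IsLocalModelOf k L W S →
    ∀ (d : ℕ) (x : Fin d → L), (∀ j, x j ∈ S) →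
      Ideal.span {s : S | (s : L) ∈ Set.range x} = maximalIdeal S → ringKrullDim S = d →
    ∀ (V C : Matrix (Fin d) (Fin d) ℤ), V * C = 1 → (∀ i j, 0 ≤ C i j) →
    ∀ (y : Fin d → L), (∀ i, y i = ∏ j, x j ^ V i j) → (∀ i, y i ∈ W) →
      ∃ (m : ℕ) (P : Fin m → MvPolynomial {i : Fin d // W.valuation (y i) = 1} S)
        (_ : IsLocalRing (locModel W (S ⊔ Algebra.adjoin k (Set.range y)))),
        Fintype.card {i : Fin d // W.valuation (y i) < 1} + m = d ∧
        Ideal.span {s : locModel W (S ⊔ Algebra.adjoin k (Set.range y)) |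
            (s : L) ∈ y '' {i | W.valuation (y i) < 1} ∪
              Set.range (fun j => MvPolynomial.aeval
                (fun i : {i : Fin d // W.valuation (y i) = 1} => y i.1) (P j))} =
          maximalIdeal (locModel W (S ⊔ Algebra.adjoin k (Set.range y)))

end

/-! ## Node N2a from N2a′: lifting the coefficients through `F ↠ κ(S)` (PROVED) -/

/-- **Node N2a PROVED from N2a′.** [CP-I] Lemma 9.4, HAL p. 29 l. 55–56: "`κ(R₁) = κ(S₁)`, so
that there exist `γ₂, γ₃ ∈ R₁` such that `S₁` has r.s.p. `(z₁ := y₁, z₂ := y₂ − γ₂,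
z₃ := y₃ − γ₃)`".  Given generators `y_{I₊}, P_j(y_{I₀})` of `m_{S₁}` with `P_j ∈ S[Y_{I₀}]`
and a set `F ⊆ S` mapping onto `κ(S)`, replace each coefficient `c` by a lift `c' ∈ F` of its
residue: `P'_j(y_{I₀}) - P_j(y_{I₀}) = ∑ (c' - c) y^n ∈ m_S·S₁`, and `m_S·S₁ ⊆ (y_{I₊})S₁`
because `m_S = (x)` and each `x_j = ∏ y_i^{C_{ji}}` (property (b), `eq_prod_pow_toNat_of_mul_eq_one`)
involves some `y_i` of positive value (`W(x_j) > 0`); hence `(y_{I₊}, P'_j(y_{I₀}))` generates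
the same ideal `m_{S₁}`.
[cite: CossartPiltant2008, Section 9, Lemma 9.4 (HAL p. 29 l. 48–59)] -/
theorem monomialChartCentre_of_self (h : MonomialChartCentreSelf.{u}) :
    MonomialChartCentre.{u} := by
  intro k L _ _ _ W hk hres S hSreg hS d x hxS hspanx hdimS V C hVC hC y hy hyW F hFS hFres
  classical
  obtain ⟨m, P, hloc, hcard, hspan⟩ := h k L W hk hres S hS d x hxS hspanx hdimS V C hVC hC y hy hyW
  haveI := hloc
  -- the chart `S₁ := (S[y])_{m_W ∩ S[y]}`: a local model containing `S` and `y`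
  have hyW' : Set.range y ⊆ (W : Set L) := by
    rintro _ ⟨i, rfl⟩
    exact hyW i
  have hS₁mod : IsLocalModelOf k L W (locModel W (S ⊔ Algebra.adjoin k (Set.range y))) :=
    isLocalModelOf_locModel_sup_adjoin W hk hS (Set.finite_range y) hyW'
  have hSS₁ : S ≤ locModel W (S ⊔ Algebra.adjoin k (Set.range y)) :=
    le_sup_left.trans (le_locModel W _)
  have hyS₁ : ∀ i, y i ∈ locModel W (S ⊔ Algebra.adjoin k (Set.range y)) := fun i =>
    le_locModel W _ ((le_sup_right : Algebra.adjoin k (Set.range y) ≤ _)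
      (Algebra.subset_adjoin ⟨i, rfl⟩))
  -- lifts of residues into `F` ("there exist `γ₂, γ₃ ∈ R₁`")
  have hg : ∃ g : S → S, ∀ c : S, ((g c : S) : L) ∈ F ∧
      W.valuation ((c : L) - (g c : L)) < 1 := by
    choose g hgF hgv using fun c : S => hFres c c.2
    exact ⟨fun c => ⟨g c, hFS (hgF c)⟩, fun c => ⟨hgF c, hgv c⟩⟩
  obtain ⟨g, hg⟩ := hg
  -- property (b): `x_j = ∏ y_i^{C_{ji}}`, and some `y_i` with `W(y_i) > 0` occurs
  have hx0 : ∀ j, x j ≠ 0 := ne_zero_of_span_eq_maximalIdeal S hspanx hdimS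
  have hxprod : ∀ j, x j = ∏ i, y i ^ (C j i).toNat := fun j =>
    eq_prod_pow_toNat_of_mul_eq_one hx0 hVC hC hy j
  have hexists : ∀ j, ∃ i, W.valuation (y i) < 1 ∧ 0 < (C j i).toNat := by
    intro j
    by_contra hne
    have hzero : ∀ i, W.valuation (y i) < 1 → (C j i).toNat = 0 := fun i hi => by
      rcases Nat.eq_zero_or_pos (C j i).toNat with h0 | h0
      · exact h0
      · exact absurd ⟨i, hi, h0⟩ hne
    have hval : W.valuation (x j) = 1 := by
      rw [hxprod j, map_prod]
      refine Finset.prod_eq_one fun i _ => ?_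
      rw [map_pow]
      by_cases hi : W.valuation (y i) < 1
      · rw [hzero i hi, pow_zero]
      · rw [le_antisymm ((W.valuation_le_one_iff _).mpr (hyW i)) (not_lt.mp hi), one_pow]
    have hlt : W.valuation (x j) < 1 :=
      (hS.mem_maximalIdeal_iff ⟨x j, hxS j⟩).mp (by rw [← hspanx]; exact Ideal.subset_span ⟨j, rfl⟩)
    exact hlt.ne hval
  -- evaluation inside `S₁`: `Q(P) := P(y_{I₀}) ∈ S₁`
  have hQ : ∀ p : MvPolynomial {i : Fin d // W.valuation (y i) = 1} S,
      ((MvPolynomial.eval₂ (Subalgebra.inclusion hSS₁).toRingHom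
        (fun i : {i : Fin d // W.valuation (y i) = 1} =>
          (⟨y i.1, hyS₁ i.1⟩ : locModel W (S ⊔ Algebra.adjoin k (Set.range y)))) p :
            locModel W (S ⊔ Algebra.adjoin k (Set.range y))) : L) =
        MvPolynomial.aeval (fun i : {i : Fin d // W.valuation (y i) = 1} => y i.1) p := by
    intro p
    rw [MvPolynomial.aeval_def, MvPolynomial.eval₂_eq, MvPolynomial.eval₂_eq,
      AddSubmonoidClass.coe_finsetSum]
    refine Finset.sum_congr rfl fun n _ => ?_
    rw [MulMemClass.coe_mul, SubmonoidClass.coe_finsetProd]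
    simp_rw [SubmonoidClass.coe_pow]
    rfl
  -- the two evaluations differ by an element of any ideal containing the image of `m_S`
  have hdiff : ∀ (J : Ideal (locModel W (S ⊔ Algebra.adjoin k (Set.range y)))),
      (∀ c : S, W.valuation (c : L) < 1 → Subalgebra.inclusion hSS₁ c ∈ J) → ∀ j,
      MvPolynomial.eval₂ (Subalgebra.inclusion hSS₁).toRingHom
          (fun i : {i : Fin d // W.valuation (y i) = 1} =>
            (⟨y i.1, hyS₁ i.1⟩ : locModel W (S ⊔ Algebra.adjoin k (Set.range y))))
          (∑ n ∈ (P j).support, MvPolynomial.monomial n (g ((P j).coeff n))) -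
        MvPolynomial.eval₂ (Subalgebra.inclusion hSS₁).toRingHom
          (fun i : {i : Fin d // W.valuation (y i) = 1} =>
            (⟨y i.1, hyS₁ i.1⟩ : locModel W (S ⊔ Algebra.adjoin k (Set.range y)))) (P j) ∈ J := by
    intro J hJ j
    have hPj : MvPolynomial.eval₂ (Subalgebra.inclusion hSS₁).toRingHom
        (fun i : {i : Fin d // W.valuation (y i) = 1} =>
          (⟨y i.1, hyS₁ i.1⟩ : locModel W (S ⊔ Algebra.adjoin k (Set.range y)))) (P j) =
        ∑ n ∈ (P j).support, (Subalgebra.inclusion hSS₁).toRingHom ((P j).coeff n) *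
          n.prod (fun i e => (⟨y i.1, hyS₁ i.1⟩ :
            locModel W (S ⊔ Algebra.adjoin k (Set.range y))) ^ e) := by
      conv_lhs => rw [(P j).as_sum]
      rw [MvPolynomial.eval₂_sum]
      exact Finset.sum_congr rfl fun n _ => MvPolynomial.eval₂_monomial _ _
    rw [hPj, MvPolynomial.eval₂_sum, ← Finset.sum_sub_distrib]
    refine Ideal.sum_mem _ fun n _ => ?_
    rw [MvPolynomial.eval₂_monomial, ← sub_mul, ← map_sub]
    refine Ideal.mul_mem_right _ _ (hJ _ ?_)
    rw [AddSubgroupClass.coe_sub, Valuation.map_sub_swap]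
    exact (hg _).2
  -- the image of `m_S` lies in the ideal generated by the `y_i` of positive value (by (b))
  have hmS : ∀ c : S, W.valuation (c : L) < 1 → Subalgebra.inclusion hSS₁ c ∈
      Ideal.span {s : locModel W (S ⊔ Algebra.adjoin k (Set.range y)) |
        (s : L) ∈ y '' {i | W.valuation (y i) < 1} ∪
          Set.range (fun j => MvPolynomial.aeval
            (fun i : {i : Fin d // W.valuation (y i) = 1} => y i.1)
            (∑ n ∈ (P j).support, MvPolynomial.monomial n (g ((P j).coeff n))))} := by
    have hxJ : ∀ j, Subalgebra.inclusion hSS₁ ⟨x j, hxS j⟩ ∈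
        Ideal.span {s : locModel W (S ⊔ Algebra.adjoin k (Set.range y)) |
          (s : L) ∈ y '' {i | W.valuation (y i) < 1} ∪
            Set.range (fun j => MvPolynomial.aeval
              (fun i : {i : Fin d // W.valuation (y i) = 1} => y i.1)
              (∑ n ∈ (P j).support, MvPolynomial.monomial n (g ((P j).coeff n))))} := by
      intro j
      obtain ⟨i₁, hi₁, hpos⟩ := hexists j
      have hX : Subalgebra.inclusion hSS₁ ⟨x j, hxS j⟩ =
          ∏ i, (⟨y i, hyS₁ i⟩ : locModel W (S ⊔ Algebra.adjoin k (Set.range y))) ^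
            (C j i).toNat := by
        apply Subtype.val_injective
        simp only [Subalgebra.coe_inclusion, SubmonoidClass.coe_finsetProd,
          SubmonoidClass.coe_pow]
        exact hxprod j
      rw [hX, ← Finset.mul_prod_erase Finset.univ
        (fun i => (⟨y i, hyS₁ i⟩ : locModel W (S ⊔ Algebra.adjoin k (Set.range y))) ^
          (C j i).toNat) (Finset.mem_univ i₁)]
      refine Ideal.mul_mem_right _ _ (Ideal.pow_mem_of_mem _ ?_ _ hpos)
      exact Ideal.subset_span (Or.inl ⟨i₁, hi₁, rfl⟩)
    intro c hc
    have hcm : c ∈ Ideal.span {s : S | (s : L) ∈ Set.range x} := by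
      rw [hspanx]
      exact (hS.mem_maximalIdeal_iff c).mpr hc
    have hle : Ideal.span {s : S | (s : L) ∈ Set.range x} ≤
        Ideal.comap (Subalgebra.inclusion hSS₁) (Ideal.span
          {s : locModel W (S ⊔ Algebra.adjoin k (Set.range y)) |
            (s : L) ∈ y '' {i | W.valuation (y i) < 1} ∪
              Set.range (fun j => MvPolynomial.aeval
                (fun i : {i : Fin d // W.valuation (y i) = 1} => y i.1)
                (∑ n ∈ (P j).support, MvPolynomial.monomial n (g ((P j).coeff n))))}) := by
      rw [Ideal.span_le]
      rintro s ⟨j, hj⟩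
      have hsx : s = ⟨x j, hxS j⟩ := Subtype.ext hj.symm
      rw [SetLike.mem_coe, Ideal.mem_comap, hsx]
      exact hxJ j
    exact hle hcm
  refine ⟨m, fun j => ∑ n ∈ (P j).support, MvPolynomial.monomial n (g ((P j).coeff n)), hloc,
    ?_, hcard, le_antisymm ?_ ?_⟩
  · -- the new coefficients lie in `F`
    intro j n hn
    have hc : (∑ n' ∈ (P j).support, MvPolynomial.monomial n' (g ((P j).coeff n'))).coeff n =
        if n ∈ (P j).support then g ((P j).coeff n) else 0 := by
      simp only [MvPolynomial.coeff_sum, MvPolynomial.coeff_monomial, Finset.sum_ite_eq']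
    have hn' : n ∈ (P j).support := by
      by_contra hn'
      rw [MvPolynomial.mem_support_iff, hc, if_neg hn'] at hn
      exact hn rfl
    rw [hc, if_pos hn']
    exact (hg _).1
  · -- `(y_{I₊}, P'_j(y_{I₀})) ⊆ m_{S₁}`
    refine Ideal.span_le.mpr ?_
    rintro s (⟨i, hi, hsi⟩ | ⟨j, hsj⟩)
    · exact (hS₁mod.mem_maximalIdeal_iff s).mpr (by rw [← hsi]; exact hi)
    · have hs : s = MvPolynomial.eval₂ (Subalgebra.inclusion hSS₁).toRingHom
          (fun i : {i : Fin d // W.valuation (y i) = 1} =>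
            (⟨y i.1, hyS₁ i.1⟩ : locModel W (S ⊔ Algebra.adjoin k (Set.range y))))
          (∑ n ∈ (P j).support, MvPolynomial.monomial n (g ((P j).coeff n))) :=
        Subtype.ext (by rw [hQ]; exact hsj.symm)
      rw [SetLike.mem_coe, hs, ← add_sub_cancel (MvPolynomial.eval₂
        (Subalgebra.inclusion hSS₁).toRingHom
          (fun i : {i : Fin d // W.valuation (y i) = 1} =>
            (⟨y i.1, hyS₁ i.1⟩ : locModel W (S ⊔ Algebra.adjoin k (Set.range y)))) (P j))
        (MvPolynomial.eval₂ (Subalgebra.inclusion hSS₁).toRingHom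
          (fun i : {i : Fin d // W.valuation (y i) = 1} =>
            (⟨y i.1, hyS₁ i.1⟩ : locModel W (S ⊔ Algebra.adjoin k (Set.range y))))
          (∑ n ∈ (P j).support, MvPolynomial.monomial n (g ((P j).coeff n))))]
      refine Ideal.add_mem _ ?_ (hdiff _ (fun c hc => (hS₁mod.mem_maximalIdeal_iff _).mpr hc) j)
      rw [← hspan]
      exact Ideal.subset_span (Or.inr ⟨j, (hQ (P j)).symm⟩)
  · -- `m_{S₁} = (y_{I₊}, P_j(y_{I₀})) ⊆ (y_{I₊}, P'_j(y_{I₀}))`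
    rw [← hspan]
    refine Ideal.span_le.mpr ?_
    rintro s (⟨i, hi, hsi⟩ | ⟨j, hsj⟩)
    · exact Ideal.subset_span (Or.inl ⟨i, hi, hsi⟩)
    · have hs : s = MvPolynomial.eval₂ (Subalgebra.inclusion hSS₁).toRingHom
          (fun i : {i : Fin d // W.valuation (y i) = 1} =>
            (⟨y i.1, hyS₁ i.1⟩ : locModel W (S ⊔ Algebra.adjoin k (Set.range y)))) (P j) :=
        Subtype.ext (by rw [hQ]; exact hsj.symm)
      rw [SetLike.mem_coe, hs, ← sub_sub_cancel (MvPolynomial.eval₂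
        (Subalgebra.inclusion hSS₁).toRingHom
          (fun i : {i : Fin d // W.valuation (y i) = 1} =>
            (⟨y i.1, hyS₁ i.1⟩ : locModel W (S ⊔ Algebra.adjoin k (Set.range y))))
          (∑ n ∈ (P j).support, MvPolynomial.monomial n (g ((P j).coeff n))))
        (MvPolynomial.eval₂ (Subalgebra.inclusion hSS₁).toRingHom
          (fun i : {i : Fin d // W.valuation (y i) = 1} =>
            (⟨y i.1, hyS₁ i.1⟩ : locModel W (S ⊔ Algebra.adjoin k (Set.range y)))) (P j))]
      refine Ideal.sub_mem _ (Ideal.subset_span (Or.inr ⟨j, (hQ _).symm⟩)) (hdiff _ hmS j)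

/-! ## Re-threading: node N2, the Roots leaf and the directory's dependency statements through
the coefficient-free leaf -/

section Rethreaded

/-- **Node N2 `MonomialChartRegular` from the coefficient-free leaf N2a′**
(`monomialChartRegular_of_centre` ∘ `monomialChartCentre_of_self`).
[cite: CossartPiltant2008, Section 9, Lemma 9.4 (HAL p. 29 l. 48–59)] -/
theorem monomialChartRegular_of_self (h : MonomialChartCentreSelf.{u}) :
    MonomialChartRegular.{u} :=
  monomialChartRegular_of_centre (monomialChartCentre_of_self h)

/-- **The Roots leaf of Lemma 9.4 from the single coefficient-free, `G`-free leaf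
`MonomialChartCentreSelf`** (nodes N1 and the equivariant part of N2 are PROVED in
`InvariantRingLocalModel2008`, `MonomialChartCentre2008` and this file).
[cite: CossartPiltant2008, Lemma 9.4 proof (HAL p. 29, l. 14–65)] -/
theorem tamePrimeDescentViaStableModelRoots_of_self (h : MonomialChartCentreSelf.{u}) :
    TamePrimeDescentViaStableModelRoots.{u} :=
  tamePrimeDescentViaStableModelRoots_of_centre (monomialChartCentre_of_self h)

/-- **Lemma 9.4 from Cor. 6.3, Prop. 9.3, the coefficient-free monomial-chart leaf and (S3\*)
for inertial `W`** (`tamePrimeDescent_of_centre_of_inertia` with N2a reduced to N2a′).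
[cite: CossartPiltant2008, Lemma 9.4 (HAL pp. 28–29)] -/
theorem tamePrimeDescent_of_self_of_inertia (h63 : ClimbToInertiaField.{u})
    (h93 : DescentBelowInertiaField.{u}) (n : MonomialChartCentreSelf.{u})
    (h₂ : GStableUniformizationInertial.{u}) : TamePrimeDescent.{u} :=
  tamePrimeDescent_of_centre_of_inertia h63 h93 (monomialChartCentre_of_self n) h₂

/-- **[CP-I] Thm. 2.1 VERBATIM for reduced quasi-projective threefolds —
`resolutionQuasiProjectiveThreefolds_of_printedLeaves_residuals_centre` with node N2a reduced
to the coefficient-free leaf.**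
[cite: CossartPiltant2008, Thm 2.1 (HAL p. 3)] [cite: CossartPiltant2009, Theorem (p. 1839)]
[cite: CossartJannsenSaito2020, Introduction Thm. 1, Thm. 1.2] -/
theorem resolutionQuasiProjectiveThreefolds_of_printedLeaves_residuals_self
    (h49 : RefinedPatchingQuasiProjective.{u}) (hP : CossartPiltant2019Principalization.{u})
    (h83 : PrimeDegreeAscent.{u}) (h93 : DescentBelowInertiaField.{u})
    (n : MonomialChartCentreSelf.{u})
    (hFu : PrimaryTransformRankOne.{u}) (hBPR : BenitoPiltantReguera2022QuadraticSequence.{u})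
    (hnd : GStableUniformizationInertialRankOneNonDiscrete.{u})
    (hdi : GStableUniformizationInertialRankOneDiscreteImperfect.{u})
    (cp2 : CossartPiltant2009Main.{u}) (hE : CossartJannsenSaito2020Embedded.{u})
    (h36 : CossartJannsenSaito2020Sequence.{u}) : ResolutionQuasiProjectiveThreefolds.{u} :=
  resolutionQuasiProjectiveThreefolds_of_printedLeaves_residuals_centre h49 hP h83 h93
    (monomialChartCentre_of_self n) hFu hBPR hnd hdi cp2 hE h36

/-- **Both halves of the 2008 programme's top statement —
`cp2008_of_printedLeaves_residuals_centre` with node N2a reduced to the coefficient-free leaf.**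
[cite: CossartPiltant2008, Thm 2.1 and Thm 7.2 (HAL pp. 3–4)] [cite: CossartPiltant2009, Theorem (p. 1839)]
[cite: CossartJannsenSaito2020, Thm. 1.2] -/
theorem cp2008_of_printedLeaves_residuals_self (p49 : RefinedPatching.{u})
    (hP : CossartPiltant2019Principalization.{u}) (h83 : PrimeDegreeAscent.{u})
    (h93 : DescentBelowInertiaField.{u}) (n : MonomialChartCentreSelf.{u})
    (hFu : PrimaryTransformRankOne.{u})
    (hBPR : BenitoPiltantReguera2022QuadraticSequence.{u})
    (hnd : GStableUniformizationInertialRankOneNonDiscrete.{u})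
    (hdi : GStableUniformizationInertialRankOneDiscreteImperfect.{u})
    (cp2 : CossartPiltant2009Main.{u}) (h36 : CossartJannsenSaito2020General.{u})
    (p41 : CossartJannsenSaito2020Embedded.{u}) :
    ResolutionAffineThreefolds.{u} ∧ LU3DiffFinite.{u} :=
  cp2008_of_printedLeaves_residuals_centre p49 hP h83 h93 (monomialChartCentre_of_self n)
    hFu hBPR hnd hdi cp2 h36 p41

/-- **[CP-I] Thm. 2.1 in universe `0` with the discrete-imperfect residual reduced to its core via
Knaf–Kuhlmann — `resolutionQuasiProjectiveThreefolds_of_printedLeaves_residuals₀_centre` with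
node N2a reduced to the coefficient-free leaf.**
[cite: CossartPiltant2008, Thm 2.1 (HAL p. 3)] [cite: KnafKuhlmann2009, Thm. 1.5]
[cite: CossartJannsenSaito2020, Introduction Thm. 1, Thm. 1.2] -/
theorem resolutionQuasiProjectiveThreefolds_of_printedLeaves_residuals₀_self
    (h49 : RefinedPatchingQuasiProjective.{0}) (hP : CossartPiltant2019Principalization.{0})
    (h83 : PrimeDegreeAscent.{0}) (h93 : DescentBelowInertiaField.{0})
    (n : MonomialChartCentreSelf.{0})
    (hFu : PrimaryTransformRankOne.{0}) (hKK : KnafKuhlmann2009MonogenicCompletion)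
    (hBPR : BenitoPiltantReguera2022QuadraticSequence.{0})
    (hnd : GStableUniformizationInertialRankOneNonDiscrete.{0})
    (hdic : GStableUniformizationInertialRankOneDiscreteImperfectCore)
    (cp2 : CossartPiltant2009Main.{0}) (hE : CossartJannsenSaito2020Embedded.{0})
    (h36 : CossartJannsenSaito2020Sequence.{0}) : ResolutionQuasiProjectiveThreefolds.{0} :=
  resolutionQuasiProjectiveThreefolds_of_printedLeaves_residuals₀_centre h49 hP h83 h93
    (monomialChartCentre_of_self n) hFu hKK hBPR hnd hdic cp2 hE h36

end Rethreaded

end Literature.AlgebraicGeometry.CossartPiltant200819.CP2008
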